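import Summits.HubbardSuperconductivity.HubbardSuperconductivity.Theorems.KLProgrammeKLRegimeFlowReadScaleZeroSunsetFarRowsSup

/-!
# Route `KLProgramme`, crux K3 — engine-flow child (stmt-HubbardSuperconductivity-20437), stub (C) at `n = 0`, located item #22a «(C)-SCALE0-PT2»,
# the FAR ROWS WITH THE MIDDLE PROPAGATOR BOOKED BY ONE EXTERNAL SUP (the hypothesis the FAR-SUP certificate `…SunsetFarSupCertDefs` discharges)

Cell gate-hubbard-kl, seat p1 g22 (k3c5-p1 g15's ask, KL STATUS 2026-08-28 18:56Z, located finding «ZONE-II-MAJORANT-DEAD»: the near disk stops at `Rc = 1024`,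
everything beyond is FAR, and the far-row middle propagator must be booked by a TRUE sup ≈ 3.5·10⁻⁵ instead of `ω₁√G₀ ≈ 0.04`).  Twin of
`…SunsetFarRowsSup.farRows_le_of_l2Far_sup` (p647390) with the frequency-wise far sup family `hΨ`/`(1/β)Σ_i Ψ i` replaced by ONE hypothesis on the entries:
* **`farRows_le_of_farSup`** — if `‖A((p₀,σ′,+),((j₁,x),σ′,−))‖ ≤ S` for every far `x` (centred `x − x₀ ∉ disk`) and every grid time `j₁`, and the weighted far
  Plancherel data `hΦ` hold, then the far row `k` at `p₀` is `≤ S·((1/β)Σ_i Φ i)·(4M/β)`.  Same proof, the internal derivation of the sup removed.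
The discharge of `hA2` from `ScaleZeroFarSupCert` (+ regime) is `…SunsetFarSupEntry`; the closer twin is `…SunsetCertRowsFarSup`.

No definitions; nothing here asserts (C), any stub of 20437, K3 or superconductivity.
References: BGM 2006 §2.3 (2.17)–(2.20), §3 (3.2) [cite: BenfattoGiulianiMastropietro2006].
-/

noncomputable section

namespace Summit.HubbardSuperconductivity.HubbardSuperconductivity.Theorems.KLRegimeSplit

set_option linter.dupNamespace false -- summit = problem name (single-conjunct summit), D-0017

open Literature.MathematicalPhysics.QuantumLattice Literature.Probability.LatticeModels Literature.Analysis.FunctionSpaces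
open Summit.HubbardSuperconductivity.HubbardSuperconductivity.Theorems.DispersionFlow
open Summit.HubbardSuperconductivity.HubbardSuperconductivity.Theorems.EngineV8
open MeasureTheory Set Finset Complex UnitAddTorus Real
open scoped FourierTransform Nat ENNReal NNReal

variable {L M : ℕ} [NeZero L]

/-- **FAR ROWS UNDER AN EXTERNAL SUP OF THE MIDDLE PROPAGATOR**: `Σ_{p₁ far} w_k·|A₁A₂A₃| ≤ S·((1/β)Σ_i Φ i)·(4M/β)` when every far entry from `p₀` is `≤ S` in norm
and the weighted far Plancherel data `hΦ` hold (`0 < β` only). [cite: BenfattoGiulianiMastropietro2006, §2.3 (2.17)-(2.20)] -/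
theorem farRows_le_of_farSup [NeZero M] (c : SunsetCellRecordV2) {μ β : ℝ} (hβpos : 0 < β) (k : Fin 3) {Φ : MatsubaraIdx M → ℝ}
    (hΦ : ∀ i : MatsubaraIdx M, ∑ u : TorusSite 2 L,
      (if u ≠ 0 ∧ (fun j => (u j).valMinAbs : Site 2) ∉ c.disk then
        Real.sqrt ((((u 0).valMinAbs.natAbs : ℝ)) ^ 2 + (((u 1).valMinAbs.natAbs : ℝ)) ^ 2) ^ (k : ℕ) *
          ‖torusFourierInv (fun kv : TorusSite 2 L =>
            (fun y : Momentum => uvSymbolFn 1 klE0 (frameLevel μ 0 ((2 * π) • y)) (matsubaraFreq β M i))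
              (WithLp.toLp 2 fun j => ((kv j).val : ℝ) / L)) u‖ ^ 2
        else 0) ≤ Φ i)
    (σ : Fin 2) (p₀ : GridPoint L (2 * (2 * M))) {S : ℝ} (hS0 : 0 ≤ S)
    (hA2 : ∀ x : TorusSite 2 L, (x ≠ p₀.2 ∧ (fun j => ((x - p₀.2) j).valMinAbs : Site 2) ∉ c.disk) → ∀ j₁ : Fin (2 * (2 * M)),
      ‖((hubbardGridSub L M β (2 * (2 * M))).transpose * hubbardCovAboveCT L M β μ 0 0 klE0 * hubbardGridSub L M β (2 * (2 * M)))
          (((p₀, σ.rev), 0) : GridLeg (GridPoint L (2 * (2 * M)))) ((((j₁, x) : GridPoint L (2 * (2 * M))), σ.rev), 1)‖ ≤ S) :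
    ∑ p₁ : GridPoint L (2 * (2 * M)),
      (if p₁.2 ≠ p₀.2 ∧ (fun j => ((p₁.2 - p₀.2) j).valMinAbs : Site 2) ∉ c.disk then
        Real.sqrt ((((p₁.2 - p₀.2) 0).valMinAbs.natAbs : ℝ) ^ 2 + (((p₁.2 - p₀.2) 1).valMinAbs.natAbs : ℝ) ^ 2) ^ (k : ℕ) *
          ‖contr ℂ ((hubbardGridSub L M β (2 * (2 * M))).transpose * hubbardCovAboveCT L M β μ 0 0 klE0 *
                hubbardGridSub L M β (2 * (2 * M))) (((p₁, σ), 0) : GridLeg (GridPoint L (2 * (2 * M)))) ((p₀, σ), 1) *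
              (contr ℂ ((hubbardGridSub L M β (2 * (2 * M))).transpose * hubbardCovAboveCT L M β μ 0 0 klE0 *
                hubbardGridSub L M β (2 * (2 * M))) (((p₀, σ.rev), 0) : GridLeg (GridPoint L (2 * (2 * M)))) ((p₁, σ.rev), 1) *
                contr ℂ ((hubbardGridSub L M β (2 * (2 * M))).transpose * hubbardCovAboveCT L M β μ 0 0 klE0 *
                hubbardGridSub L M β (2 * (2 * M))) (((p₁, σ.rev), 0) : GridLeg (GridPoint L (2 * (2 * M)))) ((p₀, σ.rev), 1))‖
        else 0) ≤
      (S * ((1 / β) * ∑ i : MatsubaraIdx M, Φ i)) * (((2 * (2 * M) : ℕ) : ℝ) / β) := by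
  classical
  have hMpos : 0 < M := Nat.pos_of_ne_zero (NeZero.ne M)
  have hN : 0 < 2 * (2 * M) := by positivity
  have hNr : (0 : ℝ) < ((2 * (2 * M) : ℕ) : ℝ) := by exact_mod_cast hN
  set Cg := (hubbardGridSub L M β (2 * (2 * M))).transpose * hubbardCovAboveCT L M β μ 0 0 klE0 * hubbardGridSub L M β (2 * (2 * M)) with hCg
  -- torus Fourier inverse of the symbol at frequency `i`
  set T : MatsubaraIdx M → TorusSite 2 L → ℂ := fun i u => torusFourierInv (fun kv : TorusSite 2 L =>
      (fun y : Momentum => uvSymbolFn 1 klE0 (frameLevel μ 0 ((2 * π) • y)) (matsubaraFreq β M i))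
        (WithLp.toLp 2 fun j => ((kv j).val : ℝ) / L)) u with hT
  -- weight with the far indicator, as a function of the torus difference
  set W : TorusSite 2 L → ℝ := fun u => if u ≠ 0 ∧ (fun j => (u j).valMinAbs : Site 2) ∉ c.disk then
      Real.sqrt ((((u 0).valMinAbs.natAbs : ℝ)) ^ 2 + (((u 1).valMinAbs.natAbs : ℝ)) ^ 2) ^ (k : ℕ) else 0 with hW
  have hW0 : ∀ u, 0 ≤ W u := fun u => by simp only [hW]; split_ifs <;> positivity
  have hΦ' : ∀ i, ∑ u : TorusSite 2 L, W u * ‖T i u‖ ^ 2 ≤ Φ i := by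
    intro i
    refine le_of_eq_of_le (Finset.sum_congr rfl fun u _ => ?_) (hΦ i)
    simp only [hW, hT]
    split_ifs <;> simp
  -- Step 1: sites outside, times inside; per site the time-ℓ² identity
  rw [Fintype.sum_prod_type, Finset.sum_comm]
  have hsite : ∀ x : TorusSite 2 L,
      ∑ j₁ : Fin (2 * (2 * M)), (if ((j₁, x) : GridPoint L (2 * (2 * M))).2 ≠ p₀.2 ∧
          (fun j => ((((j₁, x) : GridPoint L (2 * (2 * M))).2 - p₀.2) j).valMinAbs : Site 2) ∉ c.disk then
        Real.sqrt ((((((j₁, x) : GridPoint L (2 * (2 * M))).2 - p₀.2) 0).valMinAbs.natAbs : ℝ) ^ 2 +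
            (((((j₁, x) : GridPoint L (2 * (2 * M))).2 - p₀.2) 1).valMinAbs.natAbs : ℝ) ^ 2) ^ (k : ℕ) *
          ‖contr ℂ Cg ((((j₁, x), σ), 0) : GridLeg (GridPoint L (2 * (2 * M)))) ((p₀, σ), 1) *
              (contr ℂ Cg (((p₀, σ.rev), 0) : GridLeg (GridPoint L (2 * (2 * M)))) (((j₁, x), σ.rev), 1) *
                contr ℂ Cg ((((j₁, x), σ.rev), 0) : GridLeg (GridPoint L (2 * (2 * M)))) ((p₀, σ.rev), 1))‖
        else 0) ≤
      W (x - p₀.2) * (S * (((2 * (2 * M) : ℕ) : ℝ) * ∑ i : MatsubaraIdx M, ‖((1 / β : ℝ) : ℂ) * T i (x - p₀.2)‖ ^ 2)) := by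
    intro x
    have hWx : W (x - p₀.2) = if x ≠ p₀.2 ∧ (fun j => ((x - p₀.2) j).valMinAbs : Site 2) ∉ c.disk then
        Real.sqrt ((((x - p₀.2) 0).valMinAbs.natAbs : ℝ) ^ 2 + (((x - p₀.2) 1).valMinAbs.natAbs : ℝ) ^ 2) ^ (k : ℕ) else 0 := by
      simp only [hW, sub_ne_zero]
    by_cases hcond : x ≠ p₀.2 ∧ (fun j => ((x - p₀.2) j).valMinAbs : Site 2) ∉ c.disk
    · simp only [hcond, and_self, if_true, ne_eq, not_false_eq_true] at hWx ⊢
      rw [hWx, ← Finset.mul_sum]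
      refine mul_le_mul_of_nonneg_left ?_ (by positivity)
      have htriple : ∀ j₁ : Fin (2 * (2 * M)),
          ‖contr ℂ Cg ((((j₁, x), σ), 0) : GridLeg (GridPoint L (2 * (2 * M)))) ((p₀, σ), 1) *
              (contr ℂ Cg (((p₀, σ.rev), 0) : GridLeg (GridPoint L (2 * (2 * M)))) (((j₁, x), σ.rev), 1) *
                contr ℂ Cg ((((j₁, x), σ.rev), 0) : GridLeg (GridPoint L (2 * (2 * M)))) ((p₀, σ.rev), 1))‖ ≤
            S * ‖Cg ((((j₁, x), σ), 0) : GridLeg (GridPoint L (2 * (2 * M)))) ((p₀, σ), 1)‖ ^ 2 := by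
        intro j₁
        rw [norm_mul, norm_mul, norm_contr_gridCov_hubbardCovAboveCT, norm_contr_gridCov_hubbardCovAboveCT, norm_contr_gridCov_hubbardCovAboveCT,
          hCg, ← gridCov_apply_spin_eq hβpos μ klE0 ((j₁, x) : GridPoint L (2 * (2 * M))) p₀ σ σ.rev]
        have h2 := hA2 x hcond j₁
        have hn1 := norm_nonneg (Cg ((((j₁, x), σ), 0) : GridLeg (GridPoint L (2 * (2 * M)))) ((p₀, σ), 1))
        have hn2 := norm_nonneg (Cg (((p₀, σ.rev), 0) : GridLeg (GridPoint L (2 * (2 * M)))) ((((j₁, x) : GridPoint L (2 * (2 * M))), σ.rev), 1))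
        rw [hCg] at h2 hn1 hn2
        nlinarith
      calc ∑ j₁ : Fin (2 * (2 * M)), ‖contr ℂ Cg ((((j₁, x), σ), 0) : GridLeg (GridPoint L (2 * (2 * M)))) ((p₀, σ), 1) *
              (contr ℂ Cg (((p₀, σ.rev), 0) : GridLeg (GridPoint L (2 * (2 * M)))) (((j₁, x), σ.rev), 1) *
                contr ℂ Cg ((((j₁, x), σ.rev), 0) : GridLeg (GridPoint L (2 * (2 * M)))) ((p₀, σ.rev), 1))‖
          ≤ ∑ j₁ : Fin (2 * (2 * M)), S * ‖Cg ((((j₁, x), σ), 0) : GridLeg (GridPoint L (2 * (2 * M)))) ((p₀, σ), 1)‖ ^ 2 :=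
            Finset.sum_le_sum fun j₁ _ => htriple j₁
        _ = S * (((2 * (2 * M) : ℕ) : ℝ) * ∑ i : MatsubaraIdx M, ‖((1 / β : ℝ) : ℂ) * T i (x - p₀.2)‖ ^ 2) := by
            rw [← Finset.mul_sum, hCg, sum_normSq_gridCov_eq_of_torusFourierInv hβpos μ p₀ x σ]
    · have hz : W (x - p₀.2) = 0 := by rw [hWx]; exact if_neg hcond
      simp only [hcond, if_false, Finset.sum_const_zero, hz, zero_mul, le_refl]
  refine (Finset.sum_le_sum fun x _ => hsite x).trans ?_
  -- Step 2: re-index `x ↦ u = x − x₀` and swap the sums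
  have hre : ∑ x : TorusSite 2 L, W (x - p₀.2) * (S * (((2 * (2 * M) : ℕ) : ℝ) * ∑ i : MatsubaraIdx M, ‖((1 / β : ℝ) : ℂ) * T i (x - p₀.2)‖ ^ 2)) =
      ∑ u : TorusSite 2 L, W u * (S * (((2 * (2 * M) : ℕ) : ℝ) * ∑ i : MatsubaraIdx M, ‖((1 / β : ℝ) : ℂ) * T i u‖ ^ 2)) :=
    Fintype.sum_equiv (Equiv.subRight p₀.2) _ _ fun x => rfl
  rw [hre]
  have hnormc : ∀ (i : MatsubaraIdx M) (u : TorusSite 2 L), ‖((1 / β : ℝ) : ℂ) * T i u‖ ^ 2 = (1 / β) ^ 2 * ‖T i u‖ ^ 2 := by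
    intro i u
    rw [norm_mul, Complex.norm_real, Real.norm_of_nonneg (by positivity), mul_pow]
  simp_rw [hnormc]
  calc ∑ u : TorusSite 2 L, W u * (S * (((2 * (2 * M) : ℕ) : ℝ) * ∑ i : MatsubaraIdx M, (1 / β) ^ 2 * ‖T i u‖ ^ 2))
      = S * ((2 * (2 * M) : ℕ) : ℝ) * (1 / β) ^ 2 * ∑ i : MatsubaraIdx M, ∑ u : TorusSite 2 L, W u * ‖T i u‖ ^ 2 := by
        rw [Finset.sum_comm]
        simp only [Finset.mul_sum]
        refine Finset.sum_congr rfl fun u _ => Finset.sum_congr rfl fun i _ => ?_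
        ring
    _ ≤ S * ((2 * (2 * M) : ℕ) : ℝ) * (1 / β) ^ 2 * ∑ i : MatsubaraIdx M, Φ i :=
        mul_le_mul_of_nonneg_left (Finset.sum_le_sum fun i _ => hΦ' i) (by positivity)
    _ = (S * ((1 / β) * ∑ i : MatsubaraIdx M, Φ i)) * (((2 * (2 * M) : ℕ) : ℝ) / β) := by
        field_simp

end Summit.HubbardSuperconductivity.HubbardSuperconductivity.Theorems.KLRegimeSplit

end
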